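import Literature.AlgebraicGeometry.Frobenioids.ModelFrobenioidRationalFunctionsProofs
import Literature.AlgebraicGeometry.Frobenioids.BiratUnitsPush
import HarnessLib

/-!
# Frobenioids I, Theorem 5.2 (ii) "Moreover": two dictionary entries for `B(A_D) ≅ O^×(A^birat)` — the
# fraction `s'·(s'')⁻¹` of a pair of pre-steps, and transport along a pre-step

Mochizuki, *The geometry of Frobenioids I: the general theory*, Kyushu J. Math. **62** (2008) 293–400, §5,
Thm. 5.2 (ii), kurims text p. 101 [cite: MochizukiFrdI2008, Thm. 5.2 (ii) p.101]: "there is a natural isomorphism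
of functors between the functor `O^×(−)` on `D` associated to the Frobenioid `C^birat` … and the functor `B`";
§4 Prop. 4.4 (iv) p. 83 ("pre-steps of `C` map to isomorphisms in `C^birat`"); and the use made of both in
Mochizuki, *The étale theta function …*, Publ. RIMS **45** (2009), §4 Def. 4.1, p. 312: "any base-equivalent pair
of pre-steps `s', s'' : A → B` in `C` determines, by inverting the image of `s''` in `C^birat`, an element
`s'·(s'')⁻¹ ∈ O^×(A^birat)`", "`f ↦ f|_B`".

PROOF-ONLY file (abc-iut cell, seat abc-iut-w5-d179; no new definitions).  abc-iut-L1-t2's explicit isomorphism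
`ModelFrobenioid.ratIso : B(A_D) ≃ O^×(A^birat)` (`ModelFrobenioidRationalFunctionsProofs.lean`; `O^×(A^birat)` =
`PreFrobenioid.BiratUnits`, classes of fractions `(α, φ)` of co-angular pre-steps INTO `A`) is related to the two
model-level operations that [EtTh] §4 reads through it (`Literature/AnabelianGeometry/EtaleTheta/BiKummerOfModel.lean`:
`fracOfModel`, `restrictAlongModel`):
* `ratIso_frac` — the model fraction `u_{s'}·u_{s''}⁻¹ ∈ B(A_D)` (`ModelFrobenioid.frac`) of a base-equivalent
  pair of linear morphisms `s', s'' : A → B` corresponds to the class `[(κ, κ')]` of ANY pair of co-angular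
  pre-steps `κ, κ' : E → A` completing the square `κ ≫ s' = κ' ≫ s''` (in `C^birat`: `s'·(s'')⁻¹ = κ⁻¹·κ'`) —
  by the uniqueness clause `pairUnit_unique` of the unit part;
* `ratIso_map_inv_baseMap` — transport of `B` along `Base(s)⁻¹` for a co-angular pre-step `s : A → B` corresponds
  to the push-forward `BiratUnits.push s` ("conjugation by the isomorphism `s` of `C^birat`",
  `BiratUnitsPush.lean`) — by the naturality clause `ratIso_natural` (Prop. 2.2 (ii)) read through
  `intertwines_iff_push_eq`.
Nothing here is specific to the abc programme; no statement of the paper is restated or strengthened.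
-/

namespace Literature.AlgebraicGeometry.Frobenioids

open CategoryTheory Opposite

universe w v u

namespace ModelFrobenioid

variable {D : Type u} [Category.{v} D] {Φ B : Dᵒᵖ ⥤ CommMonCat.{w}} {DivB : B ⟶ monoidGp Φ}

variable (hBg : Objectwise (fun M _ => IsGroupLike M) B)
  (hΦd : Objectwise (fun M _ => IsDivisorial M) Φ)
  (hF : PreFrobenioid.IsFrobenioid (toElem Φ B DivB))

/-- For linear `s', s'' : A → B` and `κ, κ' : E → A` with `κ ≫ s' = κ' ≫ s''` and `Base(κ) = Base(κ')`: the unit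
parts satisfy `B(Base κ)(u_{s'}·u_{s''}⁻¹) · u_κ = u_{κ'}` (compose the unit components of the two sides of the
square, Thm. 5.2 (i)). [cite: MochizukiFrdI2008, Thm. 5.2 (i) p.100] -/
theorem map_frac_mul_unit_eq {E A B' : ModelFrobenioid Φ B DivB} (hB : ∀ b : B.obj (op A.base), IsUnit b)
    (s' s'' : A ⟶ B') (hd' : degFr s' = 1) (hd'' : degFr s'' = 1) (κ κ' : E ⟶ A)
    (hbκ : baseMap κ = baseMap κ') (h : κ ≫ s' = κ' ≫ s'') :
    (B.map (baseMap κ).op).hom (frac hB s' s'' : B.obj (op A.base)) * unit κ = unit κ' := by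
  have eq1 : (B.map (baseMap κ).op).hom (unit s') * unit κ = (B.map (baseMap κ).op).hom (unit s'') * unit κ' := by
    have e := congrArg (fun φ : E ⟶ B' => unit φ) h
    simp only [unit_comp, hd', hd'', PNat.one_coe, pow_one] at e
    rw [← hbκ] at e
    exact e
  rw [frac, div_eq_mul_inv, Units.val_mul, map_mul, coe_unitU, mul_assoc, mul_left_comm, eq1, ← mul_assoc,
    ← map_mul, ← coe_unitU hB s'', Units.inv_mul, map_one, one_mul]

/-- **`ratIso (s'·(s'')⁻¹) = [(κ, κ')]`**: under `B(A_D) ≅ O^×(A^birat)`, the model fraction `u_{s'}·u_{s''}⁻¹` of a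
base-equivalent pair of linear morphisms `s', s'' : A → B` is the class of any pair of co-angular pre-steps
`κ, κ' : E → A` (base-equivalent) completing the square `κ ≫ s' = κ' ≫ s''` — the element "`s'·(s'')⁻¹`" of
`O^×(A^birat)` obtained "by inverting the image of `s''` in `C^birat`". [cite: MochizukiFrdI2008, Thm. 5.2 (ii) p.101] -/
theorem ratIso_frac {E A B' : ModelFrobenioid Φ B DivB} (hB : ∀ b : B.obj (op A.base), IsUnit b)
    (s' s'' : A ⟶ B') (hd' : degFr s' = 1) (hd'' : degFr s'' = 1) (κ κ' : E ⟶ A)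
    (hκ : PreFrobenioid.IsCoAngularPreStep (toElem Φ B DivB) κ) (hκ' : PreFrobenioid.IsCoAngularPreStep (toElem Φ B DivB) κ')
    (hbκ : PreFrobenioid.BaseEquivalent (toElem Φ B DivB) κ κ') (h : κ ≫ s' = κ' ≫ s'') :
    ratIso hBg hΦd hF A (frac hB s' s'' : B.obj (op A.base)) =
      PreFrobenioid.BiratUnits.mk hF ⟨E, κ, κ', hκ, hκ', hbκ⟩ := by
  haveI : IsIso (baseMap κ) := hκ.2.2
  rw [ratIso_eq_mk_iff]
  exact (pairUnit_unique hBg κ κ' (map_frac_mul_unit_eq hB s' s'' hd' hd'' κ κ' hbκ h)).symm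

/-- **`ratIso (B(Base s)⁻¹ b) = s · ratIso b`**: under `B(−) ≅ O^×((−)^birat)`, transport of `B` along the inverse
of the base isomorphism of a co-angular pre-step `s : A → B` ("`f ↦ f|_B`") is the push-forward along `s`
(conjugation by the isomorphism `s` of `C^birat`, `BiratUnits.push`) — the naturality of Thm. 5.2 (ii)
(`ratIso_natural`, Prop. 2.2 (ii)) read through `intertwines_iff_push_eq`. [cite: MochizukiFrdI2008, Thm. 5.2 (ii) p.101] -/
theorem ratIso_map_inv_baseMap {A B' : ModelFrobenioid Φ B DivB} (s : A ⟶ B')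
    (hs : PreFrobenioid.IsCoAngularPreStep (toElem Φ B DivB) s) [IsIso (baseMap s)] (b : B.obj (op A.base)) :
    ratIso hBg hΦd hF B' ((B.map (inv (baseMap s)).op).hom b) =
      PreFrobenioid.BiratUnits.push hF s hs (ratIso hBg hΦd hF A b) := by
  have nat := ratIso_natural hBg hΦd hF s hs.2.1 ((B.map (inv (baseMap s)).op).hom b)
  rw [map_map_of_comp_eq_id B (IsIso.hom_inv_id (baseMap s))] at nat
  exact ((PreFrobenioid.BiratUnits.intertwines_iff_push_eq s hs _ _).mp nat).symm

/-- The same for the UNITS of `B(A_D)` (as [EtTh] §4 uses it: `O^×(A^birat) := B(A_D)^×`, `BiKummerOfModel.lean`):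
`ratIso` of the transport `B(Base s)⁻¹` of a unit is the push-forward of `ratIso` of the unit.
[cite: MochizukiFrdI2008, Thm. 5.2 (ii) p.101] -/
theorem ratIso_units_map_inv_baseMap {A B' : ModelFrobenioid Φ B DivB} (s : A ⟶ B')
    (hs : PreFrobenioid.IsCoAngularPreStep (toElem Φ B DivB) s) [IsIso (baseMap s)] (f : (B.obj (op A.base))ˣ) :
    ratIso hBg hΦd hF B' ((Units.map (B.map (inv (baseMap s)).op).hom f : (B.obj (op B'.base))ˣ) :
        B.obj (op B'.base)) =
      PreFrobenioid.BiratUnits.push hF s hs (ratIso hBg hΦd hF A (f : B.obj (op A.base))) :=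
  ratIso_map_inv_baseMap hBg hΦd hF s hs (f : B.obj (op A.base))

end ModelFrobenioid

end Literature.AlgebraicGeometry.Frobenioids
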